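import Mathlib
import HarnessLib
import HarnessLib.Audit
import Literature.Analysis.FluidPDE.NSWave0
import Literature.Analysis.FluidPDE.ClassicalSolution
import Literature.Analysis.FluidPDE.NSLerayHopf
import Summits.NavierStokesRegularity.NavierStokesRegularity.Theorems.NavierStokesBreakdownR3
import Summits.NavierStokesRegularity.NavierStokesRegularity.Theorems.AdiabaticEddyClayUniquenessCore

/-!
# The E-C bridge: a realised Palasek tower ⇒ Clay (C) — typed interface and conditional implication

HONEST FRAMING (cell `ns-blowup`, seat `ns-blowup-ecbridge-1`, human rulings D-0035 / D-0052 /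
D-0053): this cell ATTEMPTS the negative direction of the Clay problem. LABEL: E-C (Clay (C) =
`Summit.NavierStokesRegularity.NavierStokesRegularity.NavierStokesBreakdownR3`, breakdown on `ℝ³`
WITH a smooth, rapidly decaying force). WHAT THIS IS NOT: not Navier–Stokes evidence, not a
construction; nothing below asserts that any tower exists. The file TYPES the positive side of the
cell's E-C endpoint (memo `run/shared/lean/pub/ns-blowup/ecbridge/EC-BRIDGE-v1.md`):

* §1 `TowerRates` — rates of Palasek's super-lacunary tower (arXiv:2605.13827 §3: `N_k = N₀^{b^k}`,
  `A_k = N_k^β`, `Y_k = N_k^{β-1}`) inside the cell's design constraints DC1 (`2b < β`) and DC4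
  (`β < α ≤ 5/2`, `β < 1 + √2`); pure data (cf. `…FluidComputer.PalasekTowerExponentLedger`).
* §2 `Realisation ν R` — the INTERFACE: what the source's open "Step 2" (§4) must DELIVER at
  viscosity `ν`: an exact classical solution of the FORCED system on `[0, T) × ℝ³`, a Clay datum, a
  Clay-class force smooth THROUGH `T` and silent from `T` on (R2 schedule / Rem. 1.4), finite energy
  on closed slabs before `T`, and the RATE ENVELOPE (Palasek clock, velocity floors and ceilings
  `≍ Y_k` inside a fixed ball). A `structure` = a TYPE: existence is NOT a field.
* §3 `PalasekStep2 R : Prop` — SEPARATELY, the open statement "the interface is inhabited at every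
  `ν > 0`" (`@[conjecture]`; the crux a route would file; never asserted).
* §4 the ONE non-tower debt of the chain as a named fact with locator:
  `tao_unconditional_uniqueness_velocity_forced` (Tao 2013 Cor. 11.4 WITH its force slot; the tree's
  `Literature.Analysis.FluidPDE.tao_unconditional_uniqueness_velocity` is the proved `f = 0` instance;
  the forced twin is the cell's parked W21 / KILLSHEET VII.2 G-C1).
* §5 the BRIDGE, proved: `navierStokesBreakdownR3_of_step2 : (forced Cor. 11.4) → PalasekStep2 R →
  NavierStokesBreakdownR3`, the (C)-twin of `Literature.NS.blowup_assembly` (X5a ∧ X5b ⇒ ¬(A)); on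
  the way `Realisation.isMaximalSmoothSolution` (forced X5a, unconditional).

The R2-budget ⇒ Clay-force typing lemma is the sibling `PalasekTowerForceBudget.lean`; rate
consequences (non-vacuity of DC1/DC4, Type II exponent, accumulation of the clock) are in
`PalasekTowerClayBridgeRates.lean`. Energy (R13) is not an interface clause beyond
slab-finiteness (`sup_t ‖u‖₂ ≤ ‖u 0‖₂ + ∫‖f‖₂` is forced by the equation); DC2/DC3 are consequences
any instance satisfies (Constantin–Fefferman / axisymmetric exclusions), not fields.

References: S. Palasek, arXiv:2605.13827 (2026) §3–§4 [cite: Palasek2026ElementaryModel, §3–§4];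
C. L. Fefferman, Clay problem description, (C) with (4)–(7) [cite: FeffermanClay2006, (C)];
T. Tao, Anal. PDE 6 (2013) 25–107 = arXiv:1108.1165, Cor. 11.4, Lemma 4.1 [cite: Tao2011, Cor. 11.4];
J. T. Beale, T. Kato, A. Majda, Comm. Math. Phys. 94 (1984) §1 [cite: BealeKatoMajda1984, §1].
-/

noncomputable section

namespace Summit.NavierStokesRegularity.FluidComputer.PalasekTowerClayBridge

open Set MeasureTheory Filter Topology Function
open scoped ENNReal ContDiff NNReal
open Literature.Analysis.FluidPDE
open Summit.NavierStokesRegularity.NavierStokesRegularity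

/-! ## §1 The rate parameters (DC1, DC4) -/

/-- **Rates of a Palasek tower inside the cell's design constraints DC1/DC4.** Scales
`N_k = N₀^{b^k}` (`N₀ > 1`, lacunarity `b > 1`), blow-up amplitudes `A_k = N_k^β`, intermittency
`α`; Palasek's viscous admissibility (3.2) `2b < β < α` (DC1: pump `A_{k-1}` beats dissipation
`N_k²`; back-reaction Lemma 3.2), `2 < α ≤ 5/2` (Rem. 1.5: the NS-candidate range), and the energy
window `β < 1 + √2` (R13 / DC4: `Σ_k E_k < ∞`). Pure data; no fluid object.
[cite: Palasek2026ElementaryModel, §3 (3.2) and Rem. 1.5] -/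
structure TowerRates where
  /-- base scale `N₀ > 1` -/
  N₀ : ℝ
  /-- lacunarity `b > 1`: `N_{k+1} = N_k^b` -/
  b : ℝ
  /-- amplitude exponent: `A_k = N_k^β` -/
  β : ℝ
  /-- intermittency exponent `α ∈ (2, 5/2]` -/
  α : ℝ
  one_lt_N₀ : 1 < N₀
  one_lt_b : 1 < b
  /-- DC1 / Palasek (3.2): `2b < β` -/
  two_b_lt_β : 2 * b < β
  /-- Palasek (3.2) / Lemma 3.2: `β < α` -/
  β_lt_α : β < α
  /-- Rem. 1.5: `2 < α` -/
  two_lt_α : 2 < α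
  /-- Rem. 1.5 / R6: `α ≤ 5/2` -/
  α_le : α ≤ 5 / 2
  /-- DC4 / R13: the energy window `β < 1 + √2` -/
  β_lt_one_add_sqrt_two : β < 1 + Real.sqrt 2

namespace TowerRates

variable (R : TowerRates)

/-- The frequency scale of level `k`: `N_k = N₀^{b^k}` (Palasek (nk_choice); real power — the same
expression as `Literature.Analysis.FluidPDE.PalasekObukhov.scale`, restated to keep this file's
import closure small). [cite: Palasek2026ElementaryModel, §1.2] -/
def N (k : ℕ) : ℝ := R.N₀ ^ (R.b ^ k)

/-- The blow-up amplitude (vorticity / strain scale) of level `k`: `A_k = N_k^β`. [cite: Palasek2026ElementaryModel, §3.1] -/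
def A (k : ℕ) : ℝ := R.N k ^ R.β

/-- The velocity scale of level `k`: `Y_k = A_k N_k⁻¹ = N_k^{β-1}` (TARGET §2 dictionary). [folklore] -/
def Y (k : ℕ) : ℝ := R.N k ^ (R.β - 1)

/-- DC1 in its weak form: `β > 2` (from `2 < 2b < β`). [folklore] -/
theorem two_lt_β : 2 < R.β := by
  have hb := R.one_lt_b
  have h := R.two_b_lt_β
  linarith

/-- The scales exceed one. [cite: Palasek2026ElementaryModel, §1.2] -/
theorem one_lt_N (k : ℕ) : 1 < R.N k :=
  Real.one_lt_rpow R.one_lt_N₀ (by have := R.one_lt_b; positivity)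

/-- The scales are positive. [cite: Palasek2026ElementaryModel, §1.2] -/
theorem N_pos (k : ℕ) : 0 < R.N k := lt_trans one_pos (R.one_lt_N k)

/-- The amplitudes are positive. [folklore] -/
theorem A_pos (k : ℕ) : 0 < R.A k := Real.rpow_pos_of_pos (R.N_pos k) _

/-- The scales tend to infinity (super-exponentially, but only divergence is used). [folklore] -/
theorem tendsto_N_atTop : Tendsto R.N atTop atTop := by
  have h1 : Tendsto (fun k : ℕ => R.b ^ k) atTop atTop :=
    tendsto_pow_atTop_atTop_of_one_lt R.one_lt_b
  have h2 : Tendsto (fun y : ℝ => R.N₀ ^ y) atTop atTop :=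
    tendsto_rpow_atTop_of_base_gt_one R.N₀ R.one_lt_N₀
  exact h2.comp h1

/-- The velocity scales `Y_k = N_k^{β-1}` tend to infinity (`β > 2 > 1`). [folklore] -/
theorem tendsto_Y_atTop : Tendsto R.Y atTop atTop := by
  have hβ : 0 < R.β - 1 := by linarith [R.two_lt_β]
  exact (tendsto_rpow_atTop hβ).comp R.tendsto_N_atTop

end TowerRates

/-! ## §2 The interface: what Step 2 must deliver -/

/-- **INTERFACE — a realisation of the Palasek tower with rates `R` as a TRUE forced Navier–Stokes
flow at viscosity `ν` (what the open Step 2 of arXiv:2605.13827 §4 must deliver, in the tree's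
vocabulary).** Fields: a blow-up time `T > 0`; velocity `u`, pressure `p`, force `f` with
`(u, p)` an exact classical solution of `∂ₜu + (u·∇)u = νΔu − ∇p + f`, `div u = 0` on
`[0, T) × ℝ³`; the datum `u 0` rapidly decaying (Fefferman (4)); the force smooth on the CLOSED
half-space `[0, ∞) × ℝ³` — through and past `T` — with Fefferman's space-time decay (5) and silent
from `T` on (the R2 schedule: every level's forcing is switched off before that level activates;
Remark 1.4); finite energy on every closed slab `[0, T']`, `T' < T`; and the RATE ENVELOPE inside a
fixed ball `B̄(0, radius)`: readout times `τ k ∈ [0, T)` obeying the Palasek clock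
`T - τ (k+1) ≤ c₃ / A_k` (the pump of level `k+1` is the strain `A_k` of level `k`), a velocity
floor `c₁ Y_k ≤ |u(τ k, x_k)|` at some point of the ball and the velocity ceiling `|u(t, x)| ≤ c₂ Y_k`
for `t ≤ τ k` (levels activate one at a time; `Y_k = N_k^{β-1}`; Type II and super-lacunary, see
`TowerRates.typeII_exponent` in the sibling `…ClayBridgeRates` file). This is a TYPE; no instance
is claimed anywhere (see `PalasekStep2`).
[cite: Palasek2026ElementaryModel, §4 and Rem. 1.4] [cite: FeffermanClay2006, (C) (4) (5) (6)] -/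
structure Realisation (ν : ℝ) (R : TowerRates) where
  /-- the blow-up time -/
  T : ℝ
  T_pos : 0 < T
  /-- velocity field on `[0, T) × ℝ³` (values for `t ≥ T` are irrelevant) -/
  u : ℝ → EuclideanSpace ℝ (Fin 3) → EuclideanSpace ℝ (Fin 3)
  /-- pressure -/
  p : ℝ → EuclideanSpace ℝ (Fin 3) → ℝ
  /-- the force, defined on all of `[0, ∞) × ℝ³` -/
  f : ℝ → EuclideanSpace ℝ (Fin 3) → EuclideanSpace ℝ (Fin 3)
  /-- exact classical forced Navier–Stokes on `[0, T)` (Fefferman (1), (2), (6) before `T`) -/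
  classical : IsClassicalNSSolutionOn (Ico 0 T) ν f u p
  /-- Clay datum (4): rapid decay of all derivatives of `u 0` -/
  datum_decay : HasRapidSpatialDecay (u 0)
  /-- Clay force (6): `f ∈ C^∞([0, ∞) × ℝ³)` — in particular smooth THROUGH the blow-up time -/
  force_smooth : IsSmoothOnHalfSpace f
  /-- Clay force (5): `|∂ₓ^a ∂ₜ^m f(x,t)| ≤ C (1 + |x| + t)^{-K}` -/
  force_decay : HasRapidSpaceTimeDecay f
  /-- R2 schedule / Remark 1.4: the force is silent at and after the blow-up time -/
  force_silent : ∀ t, T ≤ t → ∀ x, f t x = 0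
  /-- finite energy on every closed slab before `T` -/
  energy : ∀ T', T' < T → ∃ C : ℝ≥0∞, C < ⊤ ∧ ∀ t ∈ Icc 0 T', ∫⁻ x, ‖u t x‖ₑ ^ 2 ≤ C
  /-- radius of the ball carrying the tower -/
  radius : ℝ
  /-- readout times: at `τ k` level `k` is grown and level `k+1` not yet active -/
  τ : ℕ → ℝ
  τ_mem : ∀ k, τ k ∈ Ico 0 T
  /-- envelope constants -/
  c₁ : ℝ
  c₂ : ℝ
  c₃ : ℝ
  c₁_pos : 0 < c₁
  /-- Palasek clock: level `k+1` activates within `c₃ / A_k` of the blow-up time -/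
  clock : ∀ k, T - τ (k + 1) ≤ c₃ / R.A k
  /-- velocity floor: level `k` carries velocity `≥ c₁ Y_k = c₁ N_k^{β-1}` somewhere in the ball -/
  floor : ∀ k, ∃ x, ‖x‖ ≤ radius ∧ c₁ * R.Y k ≤ ‖u (τ k) x‖
  /-- velocity ceiling: up to `τ k` no speed exceeds `c₂ Y_k` (levels activate one at a time) -/
  ceiling : ∀ k, ∀ t ∈ Icc 0 (τ k), ∀ x, ‖u t x‖ ≤ c₂ * R.Y k

/-! ## §3 The open statement (Palasek's Step 2), SEPARATE from the interface -/

/-- **OPEN — Palasek's Step 2 for the rates `R` (conjecture-grade; never asserted in this file).**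
For every viscosity `ν > 0` the interface `Realisation ν R` is inhabited: the super-lacunary
forced Obukhov blow-up with rates `R` is realised by a true forced Navier–Stokes flow with Clay
data and a Clay-class force. This is the statement a route would file as its crux; the source
calls it "a plausible candidate" and leaves it open (§4). [cite: Palasek2026ElementaryModel, §4] -/
@[conjecture] def PalasekStep2 (R : TowerRates) : Prop :=
  ∀ ν : ℝ, 0 < ν → Nonempty (Realisation ν R)

/-! ## §4 The one printed debt: unconditional uniqueness WITH forcing -/

/-- T. Tao, *Localisation and compactness properties of the Navier–Stokes global regularity
problem*, Anal. PDE 6 (2013) 25–107 = arXiv:1108.1165, **Corollary 11.4 (arXiv Cor. 71,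
Unconditional uniqueness) in the FORCED case, velocity form, for Schwartz-class forcing**: let
`ν > 0`, `0 < T < ∞`, `u₀ ∈ H¹` (`u₀, ∇u₀ ∈ L²`), and let the force `f` be smooth on `[0,∞) × ℝ³`
with Fefferman's space-time decay (5) (so `(u₀, f, T)` is smooth `H¹` data in the sense of Tao's
Def. 1.1: `f ∈ L^∞_t H¹_x`). If `(u, p)` and `(v, q)` are classical solutions of the forced system,
jointly smooth on `[0, T] × ℝ³`, with `u 0 = v 0 = u₀` and finite energy `sup_{[0,T]} ∫|u|² < ∞`,
`sup_{[0,T]} ∫|v|² < ∞`, then `u t = v t` on `[0, T]`. (Printed for almost smooth solutions with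
normalised pressure; Lemma 4.1 (i) = arXiv Lemma 25 (i), stated WITH `f`, normalises the pressure
of any finite-energy almost smooth solution up to `c(t)`, which does not affect `∇p`; `ν > 0` by
the scaling (31).) The tree's `Literature.Analysis.FluidPDE.tao_unconditional_uniqueness_velocity`
is the `f = 0` instance and is proved (`…_holds`); this forced twin is the cell's parked
vendoring item W21 / KILLSHEET VII.2 G-C1 and is NOT proved here.
[cite: Tao2011, Cor. 11.4 and Lemma 4.1 (i)] [file Analysis/FluidPDE/NSUnconditionalUniqueness] -/
def tao_unconditional_uniqueness_velocity_forced : Prop :=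
  ∀ (ν T : ℝ), 0 < ν → 0 < T →
    ∀ (u₀ : EuclideanSpace ℝ (Fin 3) → EuclideanSpace ℝ (Fin 3)),
      MemLp u₀ 2 volume → MemLp (fderiv ℝ u₀) 2 volume →
    ∀ (f : ℝ → EuclideanSpace ℝ (Fin 3) → EuclideanSpace ℝ (Fin 3)),
      IsSmoothOnHalfSpace f → HasRapidSpaceTimeDecay f →
    ∀ (u v : ℝ → EuclideanSpace ℝ (Fin 3) → EuclideanSpace ℝ (Fin 3))
      (p q : ℝ → EuclideanSpace ℝ (Fin 3) → ℝ),
      IsClassicalNSSolutionOn (Icc 0 T) ν f u p →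
      IsClassicalNSSolutionOn (Icc 0 T) ν f v q →
      u 0 = u₀ → v 0 = u₀ →
      (∃ C : ℝ≥0∞, C < ⊤ ∧ ∀ t ∈ Icc 0 T, ∫⁻ x, ‖u t x‖ₑ ^ 2 ≤ C) →
      (∃ C : ℝ≥0∞, C < ⊤ ∧ ∀ t ∈ Icc 0 T, ∫⁻ x, ‖v t x‖ₑ ^ 2 ≤ C) →
      ∀ t ∈ Icc 0 T, u t = v t

/-! ## §5 The bridge -/

namespace Realisation

variable {ν : ℝ} {R : TowerRates} (W : Realisation ν R)

/-- The datum of a realisation is smooth (it is the slice `t = 0` of a classical solution). [folklore] -/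
theorem contDiff_datum : ContDiff ℝ ∞ (W.u 0) :=
  W.classical.contDiff_velocity (t := 0) ⟨le_rfl, W.T_pos⟩

/-- The datum of a realisation is divergence free. [folklore] -/
theorem divFree_datum : NSWave0.IsDivFree (W.u 0) :=
  W.classical.divFree 0 ⟨le_rfl, W.T_pos⟩

/-- **Uniqueness against a global Clay-class solution (given the forced Cor. 11.4).** A solution
`(v, q)` of the same forced system from the same datum, jointly smooth on `[0, ∞) × ℝ³` with
bounded energy (Fefferman's class (6)–(7)), coincides with the tower on `[0, T)`: at `t = 0` by the
initial condition, and for `0 < t < T` by `tao_unconditional_uniqueness_velocity_forced` on the closed slab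
`[0, t]`, where both are classical with finite energy and the rapidly decaying datum is `H¹`
(`ClayUniqueness.memLp_two_of_rapidDecay`). [cite: Tao2011, Cor. 11.4] -/
theorem eq_of_claySolution (hU : tao_unconditional_uniqueness_velocity_forced) (hν : 0 < ν)
    {v : ℝ → EuclideanSpace ℝ (Fin 3) → EuclideanSpace ℝ (Fin 3)}
    {q : ℝ → EuclideanSpace ℝ (Fin 3) → ℝ}
    (hv : IsSmoothOnHalfSpace v) (hq : IsSmoothOnHalfSpace q)
    (hns : IsNavierStokesSolution ν W.f (W.u 0) v q) (hE : HasBoundedEnergy v) :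
    ∀ t ∈ Ico 0 W.T, v t = W.u t := by
  intro t ht
  obtain ⟨ht0, htT⟩ := ht
  rcases ht0.eq_or_lt with h00 | ht0'
  · subst h00
    exact hns.initial
  · have hclv : IsClassicalNSSolutionOn (Ici 0) ν W.f v q :=
      (isNavierStokesSolution_and_smooth_iff.1 ⟨hns, hv, hq⟩).1
    have hv' : IsClassicalNSSolutionOn (Icc 0 t) ν W.f v q :=
      hclv.mono (fun s hs => hs.1) (uniqueDiffOn_Icc ht0')
    have hu' : IsClassicalNSSolutionOn (Icc 0 t) ν W.f W.u W.p :=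
      W.classical.mono (fun s hs => ⟨hs.1, lt_of_le_of_lt hs.2 htT⟩) (uniqueDiffOn_Icc ht0')
    have hC1 : ContDiff ℝ 1 (W.u 0) := W.contDiff_datum.of_le (by norm_cast)
    obtain ⟨hL2, hH1⟩ := Theorems.ClayUniqueness.memLp_two_of_rapidDecay W.datum_decay hC1
    have hEv : ∃ C : ℝ≥0∞, C < ⊤ ∧ ∀ s ∈ Icc 0 t, ∫⁻ x, ‖v s x‖ₑ ^ 2 ≤ C := by
      obtain ⟨C, hC, hb⟩ := hE
      exact ⟨C, hC, fun s hs => hb s hs.1⟩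
    have hEu : ∃ C : ℝ≥0∞, C < ⊤ ∧ ∀ s ∈ Icc 0 t, ∫⁻ x, ‖W.u s x‖ₑ ^ 2 ≤ C := W.energy t htT
    exact hU ν t hν ht0' (W.u 0) hL2 hH1 W.f W.force_smooth W.force_decay v W.u q W.p hv' hu'
      hns.initial rfl hEv hEu t ⟨ht0, le_rfl⟩

/-- **The floors forbid continuity up to `T` on the tower's ball.** No field `v` that agrees with
the tower on `[0, T)` is (jointly) continuous on the compact box `[0, T] × B̄(0, radius)`: it would
be bounded there, whereas the velocity floors `c₁ N_k^{β-1} → ∞` are attained at the points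
`(τ k, x_k)` of the box. (Pure bookkeeping: compactness + divergence of the rates.) [folklore] -/
theorem false_of_continuousOn_box
    {v : ℝ → EuclideanSpace ℝ (Fin 3) → EuclideanSpace ℝ (Fin 3)}
    (hcont : ContinuousOn (uncurry v)
      (Icc (0 : ℝ) W.T ×ˢ Metric.closedBall (0 : EuclideanSpace ℝ (Fin 3)) W.radius))
    (heq : ∀ t ∈ Ico 0 W.T, v t = W.u t) : False := by
  set K : Set (ℝ × EuclideanSpace ℝ (Fin 3)) :=
    Icc (0 : ℝ) W.T ×ˢ Metric.closedBall (0 : EuclideanSpace ℝ (Fin 3)) W.radius with hKdef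
  have hK : IsCompact K := isCompact_Icc.prod (isCompact_closedBall _ _)
  obtain ⟨M, hM⟩ := hK.exists_bound_of_continuousOn hcont
  -- the floors diverge: pick `k` with `c₁ Y_k > M`
  have hc₁ : 0 < W.c₁ := W.c₁_pos
  have hev : ∀ᶠ k in atTop, M / W.c₁ + 1 ≤ R.Y k :=
    R.tendsto_Y_atTop.eventually (eventually_ge_atTop (M / W.c₁ + 1))
  obtain ⟨k, hk⟩ := hev.exists
  obtain ⟨x, hxR, hfloor⟩ := W.floor k
  have hxK : x ∈ Metric.closedBall (0 : EuclideanSpace ℝ (Fin 3)) W.radius := by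
    rw [Metric.mem_closedBall, dist_zero_right]
    exact hxR
  have hmem : (W.τ k, x) ∈ K := mk_mem_prod ⟨(W.τ_mem k).1, (W.τ_mem k).2.le⟩ hxK
  have hbound := hM _ hmem
  have hvk : v (W.τ k) = W.u (W.τ k) := heq _ (W.τ_mem k)
  simp only [Function.uncurry_apply_pair, hvk] at hbound
  have h3 : M / W.c₁ < R.Y k := by linarith
  have h4 : M < R.Y k * W.c₁ := (div_lt_iff₀ hc₁).1 h3
  have h5 : M < W.c₁ * R.Y k := by rwa [mul_comm] at h4
  linarith

/-- **A realisation is a maximal smooth solution with lifespan `T` (the forced twin of the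
cell's `X5a` shape, `Literature.Analysis.FluidPDE.IsMaximalSmoothSolution`)** — independently of
any uniqueness theorem: a classical extension to `[0, T')`, `T' > T`, agreeing with `u` on `[0, T)`
is jointly smooth, hence continuous on the box `[0, T] × B̄(0, radius) ⊆ [0, T') × ℝ³`, which the
floors forbid (`false_of_continuousOn_box`). So the interface encodes a genuine finite-time loss
of smoothness at `T` (Beale–Kato–Majda vocabulary). [cite: BealeKatoMajda1984, §1] -/
theorem isMaximalSmoothSolution : IsMaximalSmoothSolution ν W.f W.u W.p W.T := by
  refine ⟨W.classical, ?_⟩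
  rintro ⟨T', hT', u', p', hcl', heq⟩
  refine W.false_of_continuousOn_box (v := u') ?_ heq
  have hsub : Icc (0 : ℝ) W.T ×ˢ Metric.closedBall (0 : EuclideanSpace ℝ (Fin 3)) W.radius ⊆
      Ico (0 : ℝ) T' ×ˢ (univ : Set (EuclideanSpace ℝ (Fin 3))) :=
    prod_mono (fun s hs => ⟨hs.1, lt_of_le_of_lt hs.2 hT'⟩) (subset_univ _)
  exact (ContDiffOn.continuousOn hcl'.smooth_velocity).mono hsub

/-- **No global Clay-class solution shares the tower's datum and force (given the forced
Cor. 11.4).** Such a solution would coincide with the tower on `[0, T)`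
(`eq_of_claySolution`), yet it is continuous on the compact box `[0, T] × B̄(0, radius)`, which the
floors forbid (`false_of_continuousOn_box`). [cite: FeffermanClay2006, (C)] -/
theorem not_exists_claySolution (hU : tao_unconditional_uniqueness_velocity_forced) (hν : 0 < ν) :
    ¬ ∃ (v : ℝ → EuclideanSpace ℝ (Fin 3) → EuclideanSpace ℝ (Fin 3))
        (q : ℝ → EuclideanSpace ℝ (Fin 3) → ℝ),
        IsSmoothOnHalfSpace v ∧ IsSmoothOnHalfSpace q ∧
          IsNavierStokesSolution ν W.f (W.u 0) v q ∧ HasBoundedEnergy v := by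
  rintro ⟨v, q, hv, hq, hns, hE⟩
  have heq : ∀ t ∈ Ico 0 W.T, v t = W.u t := W.eq_of_claySolution hU hν hv hq hns hE
  refine W.false_of_continuousOn_box (v := v) ?_ heq
  have hsub : Icc (0 : ℝ) W.T ×ˢ Metric.closedBall (0 : EuclideanSpace ℝ (Fin 3)) W.radius ⊆
      Ici (0 : ℝ) ×ˢ (univ : Set (EuclideanSpace ℝ (Fin 3))) :=
    prod_mono (fun s hs => hs.1) (subset_univ _)
  exact (ContDiffOn.continuousOn hv).mono hsub

end Realisation

/-- **THE E-C BRIDGE.** If Tao's unconditional uniqueness holds with its printed force slot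
(`tao_unconditional_uniqueness_velocity_forced`, Cor. 11.4 of Anal. PDE 6 (2013)) and Palasek's Step 2 is
realised for the rates `R` at every viscosity (`PalasekStep2 R`), then Fefferman's breakdown
statement (C) `NavierStokesBreakdownR3` holds: at each `ν > 0` take `u₀ := u 0` and the tower's own
force `f`; both are of Clay class by the interface, and no smooth bounded-energy solution exists by
`Realisation.not_exists_claySolution`. Conditional on BOTH hypotheses; neither is asserted.
[cite: FeffermanClay2006, (C)] [cite: Palasek2026ElementaryModel, §4] [cite: Tao2011, Cor. 11.4] -/
theorem navierStokesBreakdownR3_of_step2 (R : TowerRates) (hU : tao_unconditional_uniqueness_velocity_forced)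
    (h : PalasekStep2 R) :
    Summit.NavierStokesRegularity.NavierStokesRegularity.NavierStokesBreakdownR3 := by
  intro ν hν
  obtain ⟨W⟩ := h ν hν
  exact ⟨W.u 0, W.f, W.contDiff_datum, W.divFree_datum, W.datum_decay, W.force_smooth,
    W.force_decay, W.not_exists_claySolution hU hν⟩

/-- The summit-side conjecture leaf (C) and the Literature vocabulary copy
`Literature.Analysis.FluidPDE.NavierStokesBreakdownR3` (NSWave0.lean, ns.S03) are the same
statement, verbatim. [cite: FeffermanClay2006, (C)] -/
theorem navierStokesBreakdownR3_iff_literature :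
    Summit.NavierStokesRegularity.NavierStokesRegularity.NavierStokesBreakdownR3 ↔
      Literature.Analysis.FluidPDE.NavierStokesBreakdownR3 :=
  Iff.rfl

/-- **THE E-C BRIDGE, Literature spelling of (C).** [cite: FeffermanClay2006, (C)] -/
theorem literature_navierStokesBreakdownR3_of_step2 (R : TowerRates)
    (hU : tao_unconditional_uniqueness_velocity_forced) (h : PalasekStep2 R) :
    Literature.Analysis.FluidPDE.NavierStokesBreakdownR3 :=
  navierStokesBreakdownR3_iff_literature.1 (navierStokesBreakdownR3_of_step2 R hU h)

end Summit.NavierStokesRegularity.FluidComputer.PalasekTowerClayBridge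

end
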